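import Summits.PneNP.Statement
import Literature.Computability.Complexity.NegationLimited
import Literature.Computability.Complexity.ClayProblem
import Mathlib

/-!
# PneNP / NegLimited — the sub-Markov negation budget is vacuous

Route `PneNP/NegLimited`, cruxes `stmt-PneNP-0411` (budget `⌊ε log₂ n⌋`) and `stmt-PneNP-0412`
(budget `c · log₂ log₂ n`). Both are typed as
`∃ L ∈ NP, …, ∃ᶠ n, ∀ C over {∧₂, ∨₂, ¬} computing L_n with ≤ b(n) NOT gates, n^k < C.size`.
By Markov's lower bound (`Literature.Computability.Complexity.markov_lower`, Jukna 2012 §10.2: every De Morgan circuit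
for `f` has at least `⌈log₂ (d(f)+1)⌉` NOT gates, `d(f)` the decrease) the universally
quantified circuits do not exist as soon as `b(n) < ⌈log₂ (d(L_n)+1)⌉`, e.g. for PARITY
(`d = ⌊n/2⌋`, so `⌈log₂(d+1)⌉ ≥ log₂ n - 1 > ⌊ε log₂ n⌋` for `ε < 1`, and `> c log₂ log₂ n` for
every `c`). Hence, given `markov_lower` and any NP language of large decrease, both cruxes hold
with NO circuit-size content whatsoever. This file records that implication (sorry-free); the
repair is to measure `Literature.CplxCore.negLimitedSizeOver deMorganBasis b (L.sliceFn n)` (junk `0`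
when no admissible circuit exists, so `n^k < …` forces existence) or to require monotone,
non-constant slices.
-/

namespace PneNP.NegLimited

open Filter Literature.Computability.Complexity Literature.Computability.Complexity.Nondeterministic

/-- Core vacuity lemma: if the NOT-budget `b n` is eventually below Markov's bound
`⌈log₂ (d(L_n)+1)⌉`, then (given Markov's lower bound as the named fact `markov_lower`) every
"all admissible circuits are large" statement about `L` with budget `b` holds vacuously, for every
exponent `k`. [cite: Jukna2012, §10.2 Thm. (Markov 1957)] -/
theorem frequently_forall_circuit_of_budget_lt_markov (hM : markov_lower) (L : Language Bool)
    {b : ℕ → ℕ} (hb : ∀ᶠ n in atTop, b n < Nat.clog 2 (decrease (L.sliceFn n) + 1)) (k : ℕ) :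
    ∃ᶠ n in atTop, ∀ C : Circuit (Fin n), C.IsOver deMorganBasis → C.Computes (L.sliceFn n) →
      C.sizeWith (fun g => if g = GateFn.not then 1 else 0) ≤ b n → n ^ k < C.size := by
  refine Eventually.frequently (hb.mono fun n hn C hB hC hneg => ?_)
  have hlow := hM _ C hB hC
  have hfun : (fun g : Gate (Fin n) => negWeight g.fn) =
      (fun g => if g.fn = GateFn.not then 1 else 0) := by
    funext g; unfold negWeight; congr 1
  have hcnt : C.negationCount ≤ b n := by
    rw [Circuit.negationCount_eq, Circuit.sizeWith, hfun]; exact hneg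
  exact absurd (hlow.trans hcnt) (not_le.2 hn)

/-- `stmt-PneNP-0412` (budget `c · log₂ log₂ n`, exact conclusion shape) follows from Markov's
lower bound and the existence of ONE NP language whose slices have decrease outgrowing every
`c log₂ log₂ n` on the `⌈log₂ (d+1)⌉` scale (PARITY: `d(⊕ₙ) = ⌊n/2⌋`), with no lower bound on
circuit size proved anywhere: the crux as typed is vacuous below Markov's budget. [folklore] -/
theorem crux0412_of_markov_lower (hM : markov_lower)
    (hpar : ∃ L ∈ NP, ∀ c : ℕ, ∀ᶠ n in atTop,
      c * Nat.log 2 (Nat.log 2 n) < Nat.clog 2 (decrease (L.sliceFn n) + 1)) :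
    ∀ c : ℕ, ∃ L ∈ Literature.Computability.Complexity.Nondeterministic.NP, ∀ k : ℕ, ∃ᶠ n in Filter.atTop,
      ∀ C : Literature.Computability.Complexity.Circuit (Fin n), C.IsOver Literature.Computability.Complexity.deMorganBasis →
        C.Computes (L.sliceFn n) →
        C.sizeWith (fun g => if g = Literature.Computability.Complexity.GateFn.not then 1 else 0) ≤
          c * Nat.log 2 (Nat.log 2 n) → n ^ k < C.size := by
  intro c
  obtain ⟨L, hL, h⟩ := hpar
  exact ⟨L, hL, fun k => frequently_forall_circuit_of_budget_lt_markov hM L (h c) k⟩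

/-- `stmt-PneNP-0411` (budget `⌊ε log₂ n⌋`, exact conclusion shape) likewise follows from
Markov's lower bound and ONE NP language with `⌊ε log₂ n⌋ < ⌈log₂ (d(L_n)+1)⌉` eventually for
some `ε > 0` (PARITY with any `ε < 1`), with no circuit-size content. [folklore] -/
theorem crux0411_of_markov_lower (hM : markov_lower)
    (hpar : ∃ L ∈ NP, ∃ ε : ℝ, 0 < ε ∧ ∀ᶠ n : ℕ in atTop,
      ⌊ε * Real.logb 2 n⌋₊ < Nat.clog 2 (decrease (L.sliceFn n) + 1)) :
    ∃ L ∈ Literature.Computability.Complexity.Nondeterministic.NP, ∃ ε : ℝ, 0 < ε ∧ ∀ k : ℕ, ∃ᶠ n in Filter.atTop,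
      ∀ C : Literature.Computability.Complexity.Circuit (Fin n), C.IsOver Literature.Computability.Complexity.deMorganBasis →
        C.Computes (L.sliceFn n) →
        C.sizeWith (fun g => if g = Literature.Computability.Complexity.GateFn.not then 1 else 0) ≤
          ⌊ε * Real.logb 2 n⌋₊ → n ^ k < C.size := by
  obtain ⟨L, hL, ε, hε, h⟩ := hpar
  exact ⟨L, hL, ε, hε, fun k =>
    frequently_forall_circuit_of_budget_lt_markov (b := fun n => ⌊ε * Real.logb 2 n⌋₊) hM L h k⟩

end PneNP.NegLimited
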